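import Literature.Analysis.FluidPDE.CorrectorFourierSynthesis
import Literature.Analysis.FluidPDE.NavierStokesCorrectorAntidivergence
import Literature.Analysis.FluidPDE.NavierStokesConcentrationCorrectorFacts
import Literature.Analysis.FunctionSpaces.TorusInverseLaplacianL2
import HarnessLib

/-!
# The synthesized field solves (3.2) on `[0, θ] × 𝕋^d`

Analysis/FluidPDE proof file, ninth of the files discharging
`Literature.Analysis.FluidPDE.Torus.CheskidovLuo2022LocalExistence` (objects in
`CorrectorFourierDefs`, `CorrectorFourierDataDefs`; synthesis in `CorrectorFourierSynthesis`).
Under the short-interval hypotheses, the real fields `v = vel θ u R`, `q = pres θ u R` form a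
`Torus.IsLinearizedNSSolutionOn u R 0 θ v q` (Cheskidov–Luo 2022, (3.2): the linearised,
stress-forced Navier–Stokes system in convective form, `div v = 0`, `v(0) = 0`, zero means) with
the pointwise bound `‖v(t, x)‖ ≤ #d · ρ · latMass` (`isLinearizedNSSolutionOn_vel`):

* **momentum**: for each component `l` and `t ∈ [0, θ]` the complex defect
  `∂ₜVₗ + ∑ⱼ (Vⱼ∂ⱼVₗ + uⱼ∂ⱼVₗ + Vⱼ∂ⱼuₗ) + ∂ₗQ - ΔVₗ + ∑ⱼ ∂ⱼRₗⱼ` is continuous with Fourier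
  coefficients `-(P G)ₗ + Gₗ + 2πikₗ q̂ = 0` (the dictionary of `CorrectorFourierSynthesis`,
  products ↦ lattice convolutions `ScalarFourier.mFourierCoeff_mul`, and
  `projSym_pressure_identity`), hence vanishes (uniqueness of Fourier coefficients, Grafakos
  2014, Prop. 3.2.4); since all fields are real this is the real identity, and the vector
  identity follows componentwise (`Torus.convect_apply_eq`, `…_apply_comp`);
* **incompressibility**: `𝓕(∑ₗ ∂ₗVₗ) = 2πi ∑ₗ kₗ cₗ = 0`; **datum**: `c(·, 0, ·) = 0`;
  **zero means**: `𝓕(Vₗ)(0) = c(l,t,0) = 0`, `q̂(0) = 0`; **size**: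
  `|vₗ| ≤ ∑ₖ ‖c(l,t,k)‖ ≤ ρ · latMass`.

## References

* A. Cheskidov, X. Luo, arXiv:2009.06596, §3.1 (3.2), Prop. 3.2. [`CheskidovLuo2022`]
* L. Grafakos, *Classical Fourier Analysis*, 3rd ed. (2014), Prop. 3.2.4, 3.2.6 (8), §3.3.1. [`Grafakos2014`]
-/

noncomputable section

open MeasureTheory Real Set Filter Topology UnitAddTorus

namespace Literature.Analysis.FluidPDE

namespace CorrectorFourier

open scoped ComplexConjugate ContDiff
open ScalarFourier
open FourierNS (HasDecay clamp)
open Literature.Analysis.FunctionSpaces.Torus (freqNormSq IsSmooth)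

variable {d : Type*} [Fintype d] [DecidableEq d]
variable {θ : ℝ} {u : ℝ → UnitAddTorus d → EuclideanSpace ℝ d}
  {R : ℝ → UnitAddTorus d → d → EuclideanSpace ℝ d} {ρ A B : ℝ}

/-! ### Small helpers -/

/-- The Euclidean norm is bounded by the `ℓ¹` norm of the coordinates. [folklore] -/
private theorem norm_le_sum_abs_coord' (x : EuclideanSpace ℝ d) : ‖x‖ ≤ ∑ i, |x i| := by
  have hx : x = ∑ i, x i • EuclideanSpace.single i (1 : ℝ) := by
    conv_lhs => rw [← (EuclideanSpace.basisFun d ℝ).sum_repr x]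
    simp
  calc ‖x‖ = ‖∑ i, x i • EuclideanSpace.single i (1 : ℝ)‖ := by rw [← hx]
    _ ≤ ∑ i, ‖x i • EuclideanSpace.single i (1 : ℝ)‖ := norm_sum_le _ _
    _ = ∑ i, |x i| := by simp [norm_smul]

omit [DecidableEq d] in
/-- The norm of an absolutely convergent Fourier series with coefficients in the ball of order
`2#d + 1` and radius `ρ` is at most `ρ · latMass`. [folklore] -/
theorem norm_tsum_mul_mFourier_le {c : (d → ℤ) → ℂ} {ρ : ℝ} (hc : HasDecay (latOrder d + 1) ρ c)
    (x : UnitAddTorus d) : ‖∑' k, c k * mFourier k x‖ ≤ ρ * latMass d := by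
  refine tsum_of_norm_bounded ((hasSum_latWeight (d := d)).mul_left ρ) fun k => ?_
  rw [norm_mul_mFourier]
  exact (hc k).trans (mul_le_mul_of_nonneg_left (FourierNS.inv_one_add_norm_pow_anti k (Nat.le_succ _))
    hc.nonneg)

/-! ### The local solution -/

-- one long verification; the coefficient bookkeeping elaborates slowly
set_option maxHeartbeats 1600000 in
/-- **The synthesized field solves the linearised, stress-forced Navier–Stokes system (3.2) on
`[0, θ] × 𝕋^d`.** Under the short-interval hypotheses (`0 < θ ≤ 1`; `u` divergence free and `R`
jointly smooth on `[0, θ] × 𝕋^d`; order-`(2#d+1)` bounds `A`, `B` of the clamped coefficients;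
the threshold inequalities of `CorrectorFourierPicard` for the radius `ρ ≥ 0`), the real fields
`v = vel θ u R`, `q = pres θ u R` satisfy `Torus.IsLinearizedNSSolutionOn u R 0 θ v q`
(Cheskidov–Luo 2022, §3.1 (3.2): "`∂ₜvᵢ - Δvᵢ + div(vᵢ ⊗ vᵢ) + div(vᵢ ⊗ u) + div(u ⊗ vᵢ) + ∇qᵢ = -div R`,
`div vᵢ = 0`, `vᵢ(tᵢ) = 0`", in the convective form of the accepted structure) and
`‖v(t, x)‖ ≤ #d · ρ · latMass` on `[0, θ]` (the smallness of Prop. 3.2, from the ball of the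
Picard construction). [cite: CheskidovLuo2022, §3.1 (3.2) and Prop. 3.2] -/
theorem isLinearizedNSSolutionOn_vel (hθ : 0 < θ) (hθ1 : θ ≤ 1) (hu : FunctionSpaces.Torus.IsSmoothSpaceTimeOn (Icc 0 θ) u)
    (hdiv : ∀ t ∈ Icc 0 θ, FunctionSpaces.Torus.IsDivFree (u t)) (hR : FunctionSpaces.Torus.IsSmoothSpaceTimeOn (Icc 0 θ) R)
    (hρ : 0 ≤ ρ) (hA : 0 ≤ A) (hB : 0 ≤ B)
    (hUA : ∀ j t, HasDecay (latOrder d + 1) A (driftCoeff θ u j t))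
    (hRB : ∀ i j t, HasDecay (latOrder d + 1) B (stressCoeff θ R i j t))
    (hS1 : (Real.exp 1 * (1 + 1 / (2 * Real.sqrt (4 * π ^ 2 * 1))) * Real.sqrt θ) *
      (2 * Fintype.card d *
        (Fintype.card d * (2 ^ latOrder d * latMass d * (ρ * (2 * π * ρ) + ρ * (2 * π * ρ))) +
          Fintype.card d * (2 ^ latOrder d * latMass d * (A * (2 * π * ρ) + A * (2 * π * ρ))) +
          Fintype.card d * (2 ^ latOrder d * latMass d * (ρ * (2 * π * A) + ρ * (2 * π * A))) +
          Fintype.card d * (2 * π * B))) ≤ ρ)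
    (hS2 : (Real.exp 1 * (1 + 1 / (2 * Real.sqrt (4 * π ^ 2 * 1))) * Real.sqrt θ) *
      (2 * Fintype.card d *
        (Fintype.card d * (2 ^ latOrder d * latMass d * (2 * π)) * (4 * ρ + 4 * A))) ≤ 1 / 2) :
    Torus.IsLinearizedNSSolutionOn u R 0 θ (vel θ u R) (pres θ u R) ∧
    ∀ t ∈ Icc 0 θ, ∀ x, ‖vel θ u R t x‖ ≤ Fintype.card d * (ρ * latMass d) := by
  obtain ⟨hcc, hball, hdecay, hdivF, hzero, hconj, hnonpos, hderiv, hfam⟩ :=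
    solCoeff_spec hθ hθ1 hu hdiv hR hρ hA hB hUA hRB hS1 hS2
  obtain ⟨hV, hQ, hVreal, hQreal, hvel, hpres, hcV, hcVt, hcQ⟩ :=
    synth_spec hθ hθ1 hu hdiv hR hρ hA hB hUA hRB hS1 hS2
  have hUS : UniqueDiffOn ℝ (Icc 0 θ) := uniqueDiffOn_Icc hθ
  -- notation
  set c := solCoeff θ u R with hc
  set U := driftCoeff θ u with hU
  set RH := stressCoeff θ R with hRH
  set V := velC θ u R with hVdef
  set Qc := presC θ u R with hQcdef
  set v := vel θ u R with hv
  set q := pres θ u R with hq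
  -- the complex fields as casts of the real ones (as functions)
  have hVfun : ∀ l, V l = fun s y => ((v s y l : ℝ) : ℂ) := fun l => by
    funext s y; exact hVreal l s y
  have hQfun : Qc = fun s y => ((q s y : ℝ) : ℂ) := by
    funext s y; exact hQreal s y
  -- smoothness of slices
  have hvt : ∀ t ∈ Icc 0 θ, IsSmooth (v t) := fun t ht => hvel.isSmooth_slice ht
  have hut : ∀ t ∈ Icc 0 θ, IsSmooth (u t) := fun t ht => hu.isSmooth_slice ht
  have hRt : ∀ t ∈ Icc 0 θ, IsSmooth (R t) := fun t ht => hR.isSmooth_slice ht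
  have hqt : ∀ t ∈ Icc 0 θ, IsSmooth (q t) := fun t ht => hpres.isSmooth_slice ht
  have hVt : ∀ l, ∀ t ∈ Icc 0 θ, IsSmooth (V l t) := fun l t ht => (hV l).isSmooth_slice ht
  have hQt : ∀ t ∈ Icc 0 θ, IsSmooth (Qc t) := fun t ht => hQ.isSmooth_slice ht
  have hcompC : ∀ j, FunctionSpaces.Torus.IsSmoothSpaceTimeOn (Icc 0 θ) (compC u j) := isSmoothSpaceTimeOn_compC hu
  have hentryC : ∀ l j, FunctionSpaces.Torus.IsSmoothSpaceTimeOn (Icc 0 θ) (entryC R l j) := isSmoothSpaceTimeOn_entryC hR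
  have hcompCt : ∀ j, ∀ t ∈ Icc 0 θ, IsSmooth (compC u j t) := fun j t ht => (hcompC j).isSmooth_slice ht
  have hentryCt : ∀ l j, ∀ t ∈ Icc 0 θ, IsSmooth (entryC R l j t) := fun l j t ht =>
    (hentryC l j).isSmooth_slice ht
  -- summability of coefficients
  have hsumc : ∀ l t, Summable fun k => ‖c l t k‖ := fun l t =>
    summable_norm_of_hasDecay (Nat.le_succ _) (hball l t)
  ------------------------------------------------------------------
  -- the dictionary at `t ∈ [0, θ]`
  ------------------------------------------------------------------
  have hcU : ∀ j, ∀ t ∈ Icc 0 θ, ∀ m, mFourierCoeff (compC u j t) m = U j t m := by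
    intro j t ht m; rw [hU, driftCoeff_apply, FourierNS.clamp_of_mem ht]
  have hcR : ∀ l j, ∀ t ∈ Icc 0 θ, ∀ m, mFourierCoeff (entryC R l j t) m = RH l j t m := by
    intro l j t ht m; rw [hRH, stressCoeff_apply, FourierNS.clamp_of_mem ht]
  have hcVd : ∀ j l, ∀ t ∈ Icc 0 θ, ∀ m,
      mFourierCoeff (FunctionSpaces.Torus.partialDeriv j (V l t)) m = dsym j m * c l t m := by
    intro j l t ht m
    rw [FunctionSpaces.Torus.mFourierCoeff_partialDeriv (hVt l t ht) j m, hcV, dsym_apply, smul_eq_mul]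
  have hcVΔ : ∀ l, ∀ t ∈ Icc 0 θ, ∀ m,
      mFourierCoeff (FunctionSpaces.Torus.laplacian (V l t)) m =
        -((4 * π ^ 2 * freqNormSq m : ℝ) : ℂ) * c l t m := by
    intro l t ht m
    rw [mFourierCoeff_laplacian (hVt l t ht), hcV]
  have hcUd : ∀ j l, ∀ t ∈ Icc 0 θ, ∀ m,
      mFourierCoeff (FunctionSpaces.Torus.partialDeriv j (compC u l t)) m = dsym j m * U l t m := by
    intro j l t ht m
    rw [FunctionSpaces.Torus.mFourierCoeff_partialDeriv (hcompCt l t ht) j m, hcU l t ht, dsym_apply,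
      smul_eq_mul]
  have hcRd : ∀ l j, ∀ t ∈ Icc 0 θ, ∀ m,
      mFourierCoeff (FunctionSpaces.Torus.partialDeriv j (entryC R l j t)) m = dsym j m * RH l j t m := by
    intro l j t ht m
    rw [FunctionSpaces.Torus.mFourierCoeff_partialDeriv (hentryCt l j t ht) j m, hcR l j t ht, dsym_apply,
      smul_eq_mul]
  have hcQd : ∀ l, ∀ t ∈ Icc 0 θ, ∀ m,
      mFourierCoeff (FunctionSpaces.Torus.partialDeriv l (Qc t)) m = dsym l m * presCoeffField θ u R t m := by
    intro l t ht m
    rw [FunctionSpaces.Torus.mFourierCoeff_partialDeriv (hQt t ht) l m, hcQ t ht, dsym_apply, smul_eq_mul]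
  -- products ↦ lattice convolutions
  have hsumV : ∀ j t, Summable fun k => ‖mFourierCoeff (V j t) k‖ := by
    intro j t; simp_rw [hcV]; exact hsumc j t
  have hP1 : ∀ j l, ∀ t ∈ Icc 0 θ, ∀ m,
      mFourierCoeff (fun x => V j t x * FunctionSpaces.Torus.partialDeriv j (V l t) x) m =
        lconv (c j t) (fun n => dsym j n * c l t n) m := by
    intro j l t ht m
    rw [mFourierCoeff_mul (hVt j t ht).continuous (hsumV j t) ((hVt l t ht).partialDeriv j).continuous]
    have h1 : (fun n => mFourierCoeff (V j t) n) = c j t := funext fun n => hcV j t n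
    have h2 : (fun n => mFourierCoeff (FunctionSpaces.Torus.partialDeriv j (V l t)) n) =
        fun n => dsym j n * c l t n := funext fun n => hcVd j l t ht n
    rw [h1, h2]
  have hP2 : ∀ j l, ∀ t ∈ Icc 0 θ, ∀ m,
      mFourierCoeff (fun x => compC u j t x * FunctionSpaces.Torus.partialDeriv j (V l t) x) m =
        lconv (U j t) (fun n => dsym j n * c l t n) m := by
    intro j l t ht m
    rw [mFourierCoeff_mul (hcompCt j t ht).continuous (summable_norm_mFourierCoeff (hcompCt j t ht))
      ((hVt l t ht).partialDeriv j).continuous]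
    have h1 : (fun n => mFourierCoeff (compC u j t) n) = U j t := funext fun n => hcU j t ht n
    have h2 : (fun n => mFourierCoeff (FunctionSpaces.Torus.partialDeriv j (V l t)) n) =
        fun n => dsym j n * c l t n := funext fun n => hcVd j l t ht n
    rw [h1, h2]
  have hP3 : ∀ j l, ∀ t ∈ Icc 0 θ, ∀ m,
      mFourierCoeff (fun x => V j t x * FunctionSpaces.Torus.partialDeriv j (compC u l t) x) m =
        lconv (c j t) (fun n => dsym j n * U l t n) m := by
    intro j l t ht m
    rw [mFourierCoeff_mul (hVt j t ht).continuous (hsumV j t) ((hcompCt l t ht).partialDeriv j).continuous]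
    have h1 : (fun n => mFourierCoeff (V j t) n) = c j t := funext fun n => hcV j t n
    have h2 : (fun n => mFourierCoeff (FunctionSpaces.Torus.partialDeriv j (compC u l t)) n) =
        fun n => dsym j n * U l t n := funext fun n => hcUd j l t ht n
    rw [h1, h2]
  ------------------------------------------------------------------
  -- the complex momentum equation, componentwise
  ------------------------------------------------------------------
  have hcomplex : ∀ l, ∀ t ∈ Icc 0 θ, ∀ x,
      FunctionSpaces.Torus.timeDerivWithin (Icc 0 θ) (V l) t x +
        (∑ j, (V j t x * FunctionSpaces.Torus.partialDeriv j (V l t) x +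
          compC u j t x * FunctionSpaces.Torus.partialDeriv j (V l t) x +
          V j t x * FunctionSpaces.Torus.partialDeriv j (compC u l t) x)) +
        FunctionSpaces.Torus.partialDeriv l (Qc t) x - FunctionSpaces.Torus.laplacian (V l t) x +
        (∑ j, FunctionSpaces.Torus.partialDeriv j (entryC R l j t) x) = 0 := by
    intro l t ht
    -- the five terms as functions
    set T1 : UnitAddTorus d → ℂ := FunctionSpaces.Torus.timeDerivWithin (Icc 0 θ) (V l) t with hT1
    set T2 : UnitAddTorus d → ℂ := fun x => ∑ j, (V j t x * FunctionSpaces.Torus.partialDeriv j (V l t) x +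
      compC u j t x * FunctionSpaces.Torus.partialDeriv j (V l t) x +
      V j t x * FunctionSpaces.Torus.partialDeriv j (compC u l t) x) with hT2
    set T3 : UnitAddTorus d → ℂ := FunctionSpaces.Torus.partialDeriv l (Qc t) with hT3
    set T4 : UnitAddTorus d → ℂ := FunctionSpaces.Torus.laplacian (V l t) with hT4
    set T5 : UnitAddTorus d → ℂ := fun x => ∑ j, FunctionSpaces.Torus.partialDeriv j (entryC R l j t) x with hT5
    -- continuity
    have hT1c : Continuous T1 := (((hV l).timeDerivWithin hUS).isSmooth_slice ht).continuous
    have hprodc : ∀ j, Continuous fun x => V j t x * FunctionSpaces.Torus.partialDeriv j (V l t) x +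
        compC u j t x * FunctionSpaces.Torus.partialDeriv j (V l t) x +
        V j t x * FunctionSpaces.Torus.partialDeriv j (compC u l t) x := fun j =>
      (((hVt j t ht).continuous.mul ((hVt l t ht).partialDeriv j).continuous).add
        ((hcompCt j t ht).continuous.mul ((hVt l t ht).partialDeriv j).continuous)).add
        ((hVt j t ht).continuous.mul ((hcompCt l t ht).partialDeriv j).continuous)
    have hT2c : Continuous T2 := continuous_finsetSum _ fun j _ => hprodc j
    have hT3c : Continuous T3 := ((hQt t ht).partialDeriv l).continuous
    have hT4c : Continuous T4 := (hVt l t ht).laplacian.continuous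
    have hT5c : Continuous T5 := continuous_finsetSum _ fun j _ => ((hentryCt l j t ht).partialDeriv j).continuous
    -- the defect and its coefficients
    have hEc : Continuous fun x => T1 x + T2 x + T3 x - T4 x + T5 x :=
      (((hT1c.add hT2c).add hT3c).sub hT4c).add hT5c
    have hEcoeff : ∀ m, mFourierCoeff (fun x => T1 x + T2 x + T3 x - T4 x + T5 x) m = 0 := by
      intro m
      have i1 := hT1c.integrable_unitAddTorus
      have i2 := hT2c.integrable_unitAddTorus
      have i3 := hT3c.integrable_unitAddTorus
      have i4 := hT4c.integrable_unitAddTorus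
      have i5 := hT5c.integrable_unitAddTorus
      change mFourierCoeff ((((T1 + T2) + T3) - T4) + T5) m = 0
      rw [FunctionSpaces.Torus.mFourierCoeff_add (((i1.add i2).add i3).sub i4) i5,
        FunctionSpaces.Torus.mFourierCoeff_sub ((i1.add i2).add i3) i4,
        FunctionSpaces.Torus.mFourierCoeff_add (i1.add i2) i3,
        FunctionSpaces.Torus.mFourierCoeff_add i1 i2]
      -- the coefficients of the five terms
      have e1 : mFourierCoeff T1 m = -(heatRate 1 m : ℂ) * c l t m -
          projSym (fun j => U j t) (fun i j => RH i j t) (fun j => c j t) l m := hcVt l t ht m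
      have e2 : mFourierCoeff T2 m = transportSym (fun j => c j t) (c l t) m +
          transportSym (fun j => U j t) (c l t) m + transportSym (fun j => c j t) (U l t) m := by
        rw [hT2, FunctionSpaces.Torus.mFourierCoeff_finset_sum _ fun j _ => (hprodc j).integrable_unitAddTorus,
          transportSym_apply, transportSym_apply, transportSym_apply, ← Finset.sum_add_distrib,
          ← Finset.sum_add_distrib]
        refine Finset.sum_congr rfl fun j _ => ?_
        have ia : Integrable (fun x => V j t x * FunctionSpaces.Torus.partialDeriv j (V l t) x) volume :=
          ((hVt j t ht).continuous.mul ((hVt l t ht).partialDeriv j).continuous).integrable_unitAddTorus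
        have ib : Integrable (fun x => compC u j t x * FunctionSpaces.Torus.partialDeriv j (V l t) x) volume :=
          ((hcompCt j t ht).continuous.mul ((hVt l t ht).partialDeriv j).continuous).integrable_unitAddTorus
        have ic : Integrable (fun x => V j t x * FunctionSpaces.Torus.partialDeriv j (compC u l t) x) volume :=
          ((hVt j t ht).continuous.mul ((hcompCt l t ht).partialDeriv j).continuous).integrable_unitAddTorus
        change mFourierCoeff (((fun x => V j t x * FunctionSpaces.Torus.partialDeriv j (V l t) x) +
          (fun x => compC u j t x * FunctionSpaces.Torus.partialDeriv j (V l t) x)) +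
          (fun x => V j t x * FunctionSpaces.Torus.partialDeriv j (compC u l t) x)) m = _
        rw [FunctionSpaces.Torus.mFourierCoeff_add (ia.add ib) ic, FunctionSpaces.Torus.mFourierCoeff_add ia ib,
          hP1 j l t ht m, hP2 j l t ht m, hP3 j l t ht m]
      have e3 : mFourierCoeff T3 m = dsym l m * presCoeffField θ u R t m := hcQd l t ht m
      have e4 : mFourierCoeff T4 m = -((4 * π ^ 2 * freqNormSq m : ℝ) : ℂ) * c l t m := hcVΔ l t ht m
      have e5 : mFourierCoeff T5 m = ∑ j, dsym j m * RH l j t m := by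
        rw [hT5, FunctionSpaces.Torus.mFourierCoeff_finset_sum _ fun j _ =>
          ((hentryCt l j t ht).partialDeriv j).continuous.integrable_unitAddTorus]
        exact Finset.sum_congr rfl fun j _ => hcRd l j t ht m
      rw [e1, e2, e3, e4, e5, presCoeffField_apply]
      have hid := projSym_pressure_identity (fun j => U j t) (fun i j => RH i j t) (fun j => c j t) l m
      rw [convSym_apply] at hid
      rw [heatRate_apply]
      push_cast
      linear_combination hid
    -- hence the defect vanishes
    exact Torus.eq_zero_of_forall_mFourierCoeff_eq_zero hEc hEcoeff
  ------------------------------------------------------------------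
  -- the real momentum equation, componentwise, then as vectors
  ------------------------------------------------------------------
  have hreal : ∀ l, ∀ t ∈ Icc 0 θ, ∀ x,
      FunctionSpaces.Torus.timeDerivWithin (Icc 0 θ) (fun s y => v s y l) t x +
        (∑ j, (v t x j * FunctionSpaces.Torus.partialDeriv j (fun y => v t y l) x +
          u t x j * FunctionSpaces.Torus.partialDeriv j (fun y => v t y l) x +
          v t x j * FunctionSpaces.Torus.partialDeriv j (fun y => u t y l) x)) +
        FunctionSpaces.Torus.partialDeriv l (q t) x - FunctionSpaces.Torus.laplacian (fun y => v t y l) x +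
        (∑ j, FunctionSpaces.Torus.partialDeriv j (fun y => R t y j l) x) = 0 := by
    intro l t ht x
    have h := hcomplex l t ht x
    have hvl : FunctionSpaces.Torus.IsSmoothSpaceTimeOn (Icc 0 θ) (fun s y => v s y l) := hvel.apply l
    have hvtl : ∀ j, IsSmooth (fun y => v t y j) := fun j => (hvt t ht).apply j
    have hutl : ∀ j, IsSmooth (fun y => u t y j) := fun j => (hut t ht).apply j
    have hRtl : ∀ j, IsSmooth (fun y => R t y j l) := fun j =>
      ((hRt t ht).comp_clm (ContinuousLinearMap.proj (R := ℝ) (φ := fun _ : d => EuclideanSpace ℝ d) j)).apply l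
    -- rewrite every complex term as the cast of the real one
    have r1 : FunctionSpaces.Torus.timeDerivWithin (Icc 0 θ) (V l) t x =
        ((FunctionSpaces.Torus.timeDerivWithin (Icc 0 θ) (fun s y => v s y l) t x : ℝ) : ℂ) := by
      rw [hVfun l]; exact Torus.timeDerivWithin_ofReal hvl hUS ht x
    have r2 : ∀ j, V j t x = ((v t x j : ℝ) : ℂ) := fun j => hVreal j t x
    have r3 : ∀ j, FunctionSpaces.Torus.partialDeriv j (V l t) x =
        ((FunctionSpaces.Torus.partialDeriv j (fun y => v t y l) x : ℝ) : ℂ) := by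
      intro j
      have : V l t = fun y => ((v t y l : ℝ) : ℂ) := by rw [hVfun l]
      rw [this]; exact Torus.partialDeriv_ofReal (hvtl l) j x
    have r4 : ∀ j, compC u j t x = ((u t x j : ℝ) : ℂ) := fun j => rfl
    have r5 : ∀ j, FunctionSpaces.Torus.partialDeriv j (compC u l t) x =
        ((FunctionSpaces.Torus.partialDeriv j (fun y => u t y l) x : ℝ) : ℂ) := fun j =>
      Torus.partialDeriv_ofReal (hutl l) j x
    have r6 : FunctionSpaces.Torus.partialDeriv l (Qc t) x =
        ((FunctionSpaces.Torus.partialDeriv l (q t) x : ℝ) : ℂ) := by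
      have : Qc t = fun y => ((q t y : ℝ) : ℂ) := by rw [hQfun]
      rw [this]; exact Torus.partialDeriv_ofReal (hqt t ht) l x
    have r7 : FunctionSpaces.Torus.laplacian (V l t) x =
        ((FunctionSpaces.Torus.laplacian (fun y => v t y l) x : ℝ) : ℂ) := by
      have : V l t = fun y => ((v t y l : ℝ) : ℂ) := by rw [hVfun l]
      rw [this]; exact Torus.laplacian_ofReal (hvtl l) x
    have r8 : ∀ j, FunctionSpaces.Torus.partialDeriv j (entryC R l j t) x =
        ((FunctionSpaces.Torus.partialDeriv j (fun y => R t y j l) x : ℝ) : ℂ) := fun j =>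
      Torus.partialDeriv_ofReal (hRtl j) j x
    simp only [r1, r2, r3, r4, r5, r6, r7, r8, ← Complex.ofReal_mul, ← Complex.ofReal_add, ← Complex.ofReal_sub,
      ← Complex.ofReal_sum, Complex.ofReal_eq_zero] at h
    exact h
  ------------------------------------------------------------------
  -- the structure
  ------------------------------------------------------------------
  refine ⟨⟨hvel, hpres, fun t ht x => ?_, fun t ht => ?_, fun x => ?_, fun t ht => ?_, fun t ht => ?_⟩,
    fun t ht x => ?_⟩
  · -- momentum, as vectors
    have hvs : IsSmooth (v t) := hvt t ht
    have hus : IsSmooth (u t) := hut t ht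
    have hRs : IsSmooth (R t) := hRt t ht
    have hqs : IsSmooth (q t) := hqt t ht
    ext l
    rw [PiLp.sub_apply, PiLp.add_apply, PiLp.add_apply, PiLp.add_apply, PiLp.add_apply,
      ← Torus.timeDerivWithin_apply_comp hvel hUS ht x l, Torus.convect_apply_eq hvs,
      Torus.convect_apply_eq hvs, Torus.convect_apply_eq hus,
      FunctionSpaces.Torus.gradient_apply (hqs.isContDiff (by simp)), ← Torus.laplacian_apply_comp hvs,
      Torus.tensorDivergence_apply_eq hRs]
    have h := hreal l t ht x
    rw [Finset.sum_add_distrib, Finset.sum_add_distrib] at h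
    linarith
  · -- incompressibility
    intro x
    have hvs : IsSmooth (v t) := hvt t ht
    rw [FunctionSpaces.Torus.divergence]
    -- the complexified divergence has zero coefficients
    have hDc : Continuous fun y => ∑ l, FunctionSpaces.Torus.partialDeriv l (V l t) y :=
      continuous_finsetSum _ fun l _ => ((hVt l t ht).partialDeriv l).continuous
    have hDcoeff : ∀ m, mFourierCoeff (fun y => ∑ l, FunctionSpaces.Torus.partialDeriv l (V l t) y) m = 0 := by
      intro m
      rw [FunctionSpaces.Torus.mFourierCoeff_finset_sum _ fun l _ =>
        ((hVt l t ht).partialDeriv l).continuous.integrable_unitAddTorus]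
      simp_rw [hcVd _ _ t ht]
      have h := sum_dsym_mul_eq_zero (c := fun l => c l t) (fun m => hdivF t m) m
      exact h
    have hD0 := Torus.eq_zero_of_forall_mFourierCoeff_eq_zero hDc hDcoeff x
    have hcast : ∑ l, FunctionSpaces.Torus.partialDeriv l (V l t) x =
        ((∑ l, FunctionSpaces.Torus.partialDeriv l (fun y => v t y l) x : ℝ) : ℂ) := by
      rw [Complex.ofReal_sum]
      refine Finset.sum_congr rfl fun l _ => ?_
      have : V l t = fun y => ((v t y l : ℝ) : ℂ) := by rw [hVfun l]
      rw [this]; exact Torus.partialDeriv_ofReal (hvs.apply l) l x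
    rw [hcast] at hD0
    exact Complex.ofReal_eq_zero.1 hD0
  · -- zero datum
    ext l
    rw [hv, vel_apply]
    have : velC θ u R l 0 x = 0 := by
      rw [velC, torusSynth_apply]
      simp_rw [show ∀ k, solCoeff θ u R l 0 k = 0 from fun k => hnonpos l 0 le_rfl k, zero_mul]
      exact tsum_zero
    rw [this]; simp
  · -- zero mean of the velocity
    have hvs : IsSmooth (v t) := hvt t ht
    change ∫ x, v t x = 0
    ext l
    have hint : Integrable (v t) volume := hvs.integrable
    rw [show (∫ x, v t x) l = (EuclideanSpace.proj l : EuclideanSpace ℝ d →L[ℝ] ℝ) (∫ x, v t x) from rfl,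
      ← ContinuousLinearMap.integral_comp_comm _ hint]
    change ∫ x, v t x l = (0 : EuclideanSpace ℝ d) l
    have h0 : ((∫ x, v t x l : ℝ) : ℂ) = 0 := by
      rw [← integral_complex_ofReal]
      have : (fun x => ((v t x l : ℝ) : ℂ)) = V l t := by rw [hVfun l]
      rw [this, ← FunctionSpaces.Torus.mFourierCoeff_zero_eq_integral, hcV, hzero l t]
    have : ∫ x, v t x l = 0 := Complex.ofReal_eq_zero.1 h0
    rw [this]; rfl
  · -- zero mean of the pressure
    change ∫ x, q t x = 0
    have h0 : ((∫ x, q t x : ℝ) : ℂ) = 0 := by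
      rw [← integral_complex_ofReal]
      have : (fun x => ((q t x : ℝ) : ℂ)) = Qc t := by rw [hQfun]
      rw [this, ← FunctionSpaces.Torus.mFourierCoeff_zero_eq_integral, hcQ t ht, presCoeffField_apply, presCoef_apply]
      simp
    exact Complex.ofReal_eq_zero.1 h0
  · -- the pointwise bound
    calc ‖v t x‖ ≤ ∑ l, |v t x l| := norm_le_sum_abs_coord' _
      _ ≤ ∑ _l : d, ρ * latMass d := Finset.sum_le_sum fun l _ => by
          rw [hv, vel_apply]
          calc |(velC θ u R l t x).re| ≤ ‖velC θ u R l t x‖ := Complex.abs_re_le_norm _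
            _ ≤ ρ * latMass d := by
                rw [velC, torusSynth_apply]
                exact norm_tsum_mul_mFourier_le (hball l t) x
      _ = Fintype.card d * (ρ * latMass d) := by
          rw [Finset.sum_const, Finset.card_univ, nsmul_eq_mul]

end CorrectorFourier

end Literature.Analysis.FluidPDE

end
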